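import Summits.QuantumFields.YangMills.Theorems.BalabanUVNodesN07KnitTokensLandauTwo
import Summits.QuantumFields.YangMills.Theorems.BalabanUVNodesN07Row84OfEq81AtRecord
import HarnessLib

/-!
# N07 ∕ K0ᴬ at `N = 2` — FOUR OF THE FIVE KNIT TOKENS FOR THE LANDAU FAMILY MODULO PRINT's (81) AS A VALUE IDENTITY: (rng), (star_mem), (min), (c→s) at the (47)-carrying chart
# `𝔖♭.chartLin T♭` of the scheme of record, from the road's standard rows, the in-the-small numerics, the symmetry of the slot-(c) Hessian, and ONE displayed expansion identity —
# [15] (81) «`𝔉(A′) = A(U₀) + ⟨A′, J⟩ + ½⟨A′, Δ₁A′⟩ + V(A′)`» read at the record's letters on the real slice ball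

Cell `pub-ymgap`, seat `pub-ymgap-dag-n07-w3` (g29, WIDTH SEAT 3 on N07 [B11] = [15]); helper file keyed `--kind proof --supports stmt-QuantumFields-27238 --as helper` (K0ᴬ road);
count-neutral.  INTENT-6 of the seat.  = ✓`N07KnitTokensLandauTwo.knitTokens_landau_two_of_row84` with its (84)-row DISCHARGED by ✓`N07Row84OfEq81AtRecord.row84_of_eq81` from the displayed
VALUE identity (81) (on the radius-`ρ₀` real slice ball, `ρ₀ ≤ a_C` the (rng) radius) and def-Y's token `HessSymmTok Δ2` VERBATIM (§0 turns it into the symmetry of `π†(Δ(U₀)+Δ⁽²⁾)π`; a theorem for the (3.134) datum: ✓`N07Delta2OfRecordReal.hessSymmTok_of_delta2Tok`).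

## Honest labels

By-name packaging; displayed: the section's Sect. C rows (`RC`, `hCreal`, `hCtr`, `Prop4Hyp C^{sl}`, `SmallBelow`, `U₀ ∈ bgReg`), the road's standard rows (`RegimeTok`, `FrakGSliceTok`, Lie token),
the numerics, the symmetry of `π†(Δ(U₀) + Δ⁽²⁾)π`, and [15] (81) at the record AS A VALUE IDENTITY (NOT proved — [15] (26)+(47)+(78)–(80) at the record's letters: the N07 expansion programme;
n07-w1 ✓`wilsonAction4_expChart_expansion_hessOpAt` is (26) at objects); (cov) untouched.  `N = 2`; per-lattice ∕ in-the-small; nothing of Bałaban's estimates proved; K0ᴬ ⟨27238⟩ NOT closed;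
N07 NOT discharged; COUNT∕K UNMOVED; R4 is the conditional finite-𝕋⁴ rung `BalabanLadder.UV` only; finite torus at fixed `ε` — nothing continuum ∕ OS ∕ Clay.  **The Yang–Mills mass gap is NOT
proved by any of this.**  No `sorry`, no `def`, no `instance ∕ notation ∕ set_option`; standard axioms.
[cite: Balaban1985Variational, Thm 1 p.279, Prop. 5 p.294, Prop. 6 p.295, Prop. 7 p.299, (27) p.282, (47) p.285, (76) p.289, (78)–(84) p.290, (100)–(111) pp.293–294; Balaban1987RG1, (0.21) p.256]
-/

noncomputable section

open Set Metric
open scoped Matrix Matrix.Norms.L2Operator InnerProductSpace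

namespace Summit.QuantumFields.YangMills.Theorems.N07KnitTokensLandauTwoOfEq81

open Literature.MathematicalPhysics.QuantumFieldTheory.Balaban1983to89
open Literature.MathematicalPhysics.QuantumFieldTheory.Balaban1983to89.T4Continuum (T4Family)
open Literature.MathematicalPhysics.QuantumFieldTheory.Balaban1983to89.Node00
open B9Eq311TracePairing (starW)
open B11Eq103H1Complex (SiteL2K BondL2K readFun funEquiv QFun)
open B11Eq111FrakG (nabla115)
open B11Eq115Space (NegSize NegSup JetSup)
open B11Eq174Chart (Regime)
open B11Prop6Scheme (Prop4Hyp mapT)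
open B11Eq90V0GroupComposed (T47)
open Summit.QuantumFields.YangMills.Theorems.N07TraceSectorDefs (scalPartW)
open Summit.QuantumFields.YangMills.Theorems.N07LieTokAtOfRecordTwo (mem_evHerm0_ofRecord_iff)
open Summit.QuantumFields.YangMills.Theorems.N07ChartLinFlatKnitTokensTwo (knitRng_flat_two)
open Summit.QuantumFields.YangMills.Theorems.N07MinTokensOfCriticalRowAtRecord (sol_mem_kcL)
open Summit.QuantumFields.YangMills.Theorems.N07KnitTokensLandauTwo (knitTokens_landau_two_of_row84)
open Summit.QuantumFields.YangMills.Theorems.N07Row84OfEq81AtRecord (row84_of_eq81)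

/-! ## §0  The symmetry row from def-Y's token `HessSymmTok` -/

section Symm

variable (F : T4Family) (N : ℕ) {K : ℕ} (k : ℕ) (U₀ : GaugeField (F.P K) 0 (SU N)) [Fact (0 < c0Rec F K k)]
  {F' : Type*} [AddCommGroup F'] [Module ℂ F']

/-- **`HessSymmTok Δ2` ⟹ the slot-(c) Hessian `π†(Δ(U₀) + Δ⁽²⁾)π` is Hilbert-symmetric** (any `G′`, `Q′`): `⟪π†Sπx, y⟫ = ⟪Sπx, πy⟫ = ⟪πx, Sπy⟫ = ⟪x, π†Sπy⟫`.
So the `hsym` row of ✓`row84_of_eq81` IS def-Y's token (a theorem for the (3.134) datum: ✓`N07Delta2OfRecordReal.hessSymmTok_of_delta2Tok`).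
[cite: Balaban1985BackgroundPropagators, (3.119) p.419, (3.128) p.421, (3.134)–(3.135) p.422] -/
theorem hessOpOfRecord128_symm_of_hessSymmTok
    (Gp : SiteL2K ℂ (F.P K).d (fun _ => (F.P K).sitesPerDir 0) (c0Rec F K k) (WRec N) →ₗ[ℂ]
      SiteL2K ℂ (F.P K).d (fun _ => (F.P K).sitesPerDir 0) (c0Rec F K k) (WRec N))
    (Q' : SiteL2K ℂ (F.P K).d (fun _ => (F.P K).sitesPerDir 0) (c0Rec F K k) (WRec N) →ₗ[ℂ] F')
    {Δ2 : BondL2K ℂ (F.P K).d (fun _ => (F.P K).sitesPerDir 0) (c0Rec F K k) (WRec N) →ₗ[ℂ]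
      BondL2K ℂ (F.P K).d (fun _ => (F.P K).sitesPerDir 0) (c0Rec F K k) (WRec N)}
    (hS : HessSymmTok F N K k U₀ Δ2) (x y : BondL2K ℂ (F.P K).d (fun _ => (F.P K).sitesPerDir 0) (c0Rec F K k) (WRec N)) :
    ⟪hessOpOfRecord128 F N k U₀ Gp Q' Δ2 x, y⟫_ℂ = ⟪x, hessOpOfRecord128 F N k U₀ Gp Q' Δ2 y⟫_ℂ := by
  simp only [hessOpOfRecord128, LinearMap.comp_apply]
  rw [LinearMap.adjoint_inner_left, hS, ← LinearMap.adjoint_inner_right]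

end Symm

section Two

variable (F : T4Family) {K : ℕ} (k : ℕ) (Ω : ℕ → Set (Site (F.P K) 0)) (U₀ : GaugeField (F.P K) 0 (SU 2))
  [Fact (0 < (F.L : ℝ))] [Fact (0 < (F.P K).eta k)] (levB : PBond (F.P K) k → ℕ) [Fact (0 < c0Rec F K k)] [Fact (∀ c, 0 < wBRec F K k c)] (a : ℝ)
  (hposb : ∀ x, x ≠ 0 → 0 < RCLike.re ⟪x, laplaceAOfRecord F 2 k U₀ (QOfRecord F 2 k U₀) (QflatOfRecord F 2 k) a x⟫_ℂ)
  (hQ : Function.Surjective (QOfRecord F 2 k U₀)) {b C₂ c₄ aC εC : ℝ}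
  (RC : Regime (H1OfRecordAtBgFlat F 2 K k Ω U₀ levB a hposb hQ) 0 (CslOfRecord F 2 K k Ω U₀ levB) b 0 C₂ c₄ 0 aC εC)
  (hCreal : ∀ A : Space115Lit F 2 K k Ω U₀,
    ((JetSup.equiv _ _ (nabla115 ((F.P K).eta k) (unitsOfRecord F 2 U₀))).symm
        (star (JetSup.equiv _ _ (nabla115 ((F.P K).eta k) (unitsOfRecord F 2 U₀)) A)) : Space115Lit F 2 K k Ω U₀) = A →
    ‖A‖ ≤ εC + aC → ((NegSup.equiv _ _).symm (star (NegSup.equiv _ _ (CslOfRecord F 2 K k Ω U₀ levB A))) :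
      NegSize (F.L : ℝ) ((F.P K).eta k) levB 0 (Matrix (Fin 2) (Fin 2) ℂ)) = CslOfRecord F 2 K k Ω U₀ levB A)
  (hCtr : ∀ A : Space115Lit F 2 K k Ω U₀,
    ((JetSup.equiv _ _ (nabla115 ((F.P K).eta k) (unitsOfRecord F 2 U₀))).symm
        (star (JetSup.equiv _ _ (nabla115 ((F.P K).eta k) (unitsOfRecord F 2 U₀)) A)) : Space115Lit F 2 K k Ω U₀) = A →
    (∀ b, (JetSup.equiv _ _ (nabla115 ((F.P K).eta k) (unitsOfRecord F 2 U₀)) A b).trace = 0) →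
    ‖A‖ ≤ εC + aC → ∀ c, (NegSup.equiv _ _ (CslOfRecord F 2 K k Ω U₀ levB A) c).trace = 0)
  (Gp : SiteL2K ℂ (F.P K).d (fun _ => (F.P K).sitesPerDir 0) (c0Rec F K k) (WRec 2) →ₗ[ℂ]
    SiteL2K ℂ (F.P K).d (fun _ => (F.P K).sitesPerDir 0) (c0Rec F K k) (WRec 2))
  (Δ2 : BondL2K ℂ (F.P K).d (fun _ => (F.P K).sitesPerDir 0) (c0Rec F K k) (WRec 2) →ₗ[ℂ]
    BondL2K ℂ (F.P K).d (fun _ => (F.P K).sitesPerDir 0) (c0Rec F K k) (WRec 2))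
  (hposπ : ∀ x, x ≠ 0 → 0 < RCLike.re ⟪x, laplaceAOfRecordAt F 2 k U₀ (hessOpOfRecord128 F 2 k U₀ Gp (QflatOfRecord F 2 k) Δ2)
    (QOfRecord F 2 k U₀) (QflatOfRecord F 2 k) a x⟫_ℂ)

include RC hCreal hCtr in
/-- ★★★ **FOUR OF THE FIVE KNIT TOKENS FOR THE LANDAU FAMILY AT `N = 2`, MODULO (81) AS A VALUE IDENTITY.**  Given the (47)-free chart's guard `SmallBelow`, `U₀ ∈ bgReg … ε`, Prop. 4's shape for `C^{sl}`
(`Prop4Hyp`) and the Sect. C rows of the section: there are `ρ₀ > 0` (`≤ a_C`) and lattice constants `M ≥ 0`, `γ > 0` such that for ALL scheme data `dom B₀ C₄ a₃ j a𝔄 ε₄` and every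
radius `ρ ≤ ρ₀` with `ε₄ + a𝔄 ≤ ρ`, `2(ρ + 2a𝔄) ≤ a₃`, `4·M·B₀·C₄·(ρ + 2a𝔄) < γ`, under `dom ⊆ logDisc`, `S.RegimeTok`, `FrakGSliceTok`, the Lie token on `dom`, and [15] (84) at the
record for the family — the four tokens (rng), (star_mem), (min), (c→s) hold LITERALLY in the door's binder shapes for `S.chartLin T♭`, `T♭ := fun _ => T47 H₁♭ C^{sl} ε_C`, and
`Kc^L_ρ V := {A ∈ (102) | A + 𝔄V ∈ evHerm0, ‖A + 𝔄V‖ < ρ}`.  (cov) and (84) stay displayed by the consumer.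
[cite: Balaban1985Variational, Thm 1 p.279, Prop. 5 p.294, Prop. 6 p.295, Prop. 7 p.299, (47) p.285, (84) p.290, (102) p.293, (109) p.294; Balaban1987RG1, (0.21) p.256, (1.2) p.260] -/
theorem knitTokens_landau_two_of_eq81 (h : SmallBelow (avOfRecord F 2 K) k U₀) {ε : ℝ} (hU₀reg : U₀ ∈ bgReg F 2 K k ε)
    (hC : Prop4Hyp (CslOfRecord F 2 K k Ω U₀ levB) C₂ c₄) (haC : 0 < aC) (c : ℝ) (hc : 0 < c)
    (ι : Space115Lit F 2 K k Ω U₀ ≃ₗ[ℂ] BondL2K ℂ (F.P K).d (fun _ => (F.P K).sitesPerDir 0) (c0Rec F K k) (WRec 2))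
    (hι : ∀ y, ι y = (funEquiv (phiRec 2) (fun _ : B9SectCLatticeCarrier.Bond (F.P K).d (fun _ => (F.P K).sitesPerDir 0) => c0Rec F K k)).symm
      (JetSup.equiv _ _ (nabla115 ((F.P K).eta k) (unitsOfRecord F 2 U₀)) y))
    (hsym : HessSymmTok F 2 K k U₀ Δ2) :
    ∃ ρ₀ M γ : ℝ, 0 < ρ₀ ∧ ρ₀ ≤ aC ∧ 0 ≤ M ∧ 0 < γ ∧
      ∀ (dom : Set (GaugeField (F.P K) k (SU 2))) (B₀ C₄ a₃ j a𝔄 ε₄ ρ : ℝ)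
        (S : BgSchemeOnLit F 2 K k Ω U₀) (_hS : S = bgSchemeOfRecord F 2 K k Ω U₀ dom levB Gp Δ2 a hposπ hposb hQ εC B₀ C₄ a₃ j a𝔄 ε₄),
        ρ ≤ ρ₀ → ε₄ + a𝔄 ≤ ρ → 2 * (ρ + a𝔄 + a𝔄) ≤ a₃ → 4 * M * B₀ * C₄ * (ρ + a𝔄 + a𝔄) < γ →
        dom ⊆ logDiscOfRecord F 2 K k U₀ → S.RegimeTok → FrakGSliceTok F 2 K k Ω U₀ Gp Δ2 a hposπ hQ → (∀ V ∈ dom, S.LieTokAt V) →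
        ∀ a₀ : GaugeField (F.P K) k (SU 2) → ℝ,
          (∀ V ∈ dom, ∀ A' : Space115Lit F 2 K k Ω U₀, A' ∈ S.evHerm0 → ‖A'‖ < ρ₀ →
            wilsonAction4 (S.chartLin (fun _ => T47 (H1OfRecordAtBgFlat F 2 K k Ω U₀ levB a hposb hQ) (CslOfRecord F 2 K k Ω U₀ levB) εC) V (A' - S.𝔄 V)) =
              a₀ V + c * (RCLike.re ⟪ι A', (funEquiv (phiRec 2) (fun _ : B9SectCLatticeCarrier.Bond (F.P K).d (fun _ => (F.P K).sitesPerDir 0) => c0Rec F K k)).symm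
                  (NegSup.equiv _ _ (S.J V))⟫_ℂ +
                2⁻¹ * RCLike.re ⟪ι A', hessOpOfRecord128 F 2 k U₀ Gp (QflatOfRecord F 2 k) Δ2 (ι A')⟫_ℂ +
                RCLike.re (B11Eq80CurrentZpow.V80Z (tauRecCLM 2) (unitsOfRecord F 2 U₀) (H1OfRecordAtBgFlat F 2 K k Ω U₀ levB a hposb hQ)
                  (CslOfRecord F 2 K k Ω U₀ levB) εC (JOfRecordAtBg F 2 K k Ω U₀) (DeltaPiCurOfRecord F 2 K k Ω U₀ Gp (QflatOfRecord F 2 k)) A'))) →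
        -- (rng)
        (∀ V ∈ S.dom, ∀ A ∈ {A : Space115Lit F 2 K k Ω U₀ | A ∈ constraint102OfRecord F 2 K k Ω U₀ ∧ A + S.𝔄 V ∈ S.evHerm0 ∧ ‖A + S.𝔄 V‖ < ρ},
          S.chartLin (fun _ => T47 (H1OfRecordAtBgFlat F 2 K k Ω U₀ levB a hposb hQ) (CslOfRecord F 2 K k Ω U₀ levB) εC) V A ∈ bgReg F 2 K k ε ∧
          Averaging.iter (avOfRecord F 2 K) k
            (S.chartLin (fun _ => T47 (H1OfRecordAtBgFlat F 2 K k Ω U₀ levB a hposb hQ) (CslOfRecord F 2 K k Ω U₀ levB) εC) V A) = V) ∧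
        -- (star_mem)
        (∀ V ∈ S.dom, S.sol V ∈ {A : Space115Lit F 2 K k Ω U₀ | A ∈ constraint102OfRecord F 2 K k Ω U₀ ∧ A + S.𝔄 V ∈ S.evHerm0 ∧ ‖A + S.𝔄 V‖ < ρ}) ∧
        -- (min)
        (∀ V ∈ S.dom, IsMinOn (wilsonAction4 ∘ S.chartLin
              (fun _ => T47 (H1OfRecordAtBgFlat F 2 K k Ω U₀ levB a hposb hQ) (CslOfRecord F 2 K k Ω U₀ levB) εC) V)
            {A : Space115Lit F 2 K k Ω U₀ | A ∈ constraint102OfRecord F 2 K k Ω U₀ ∧ A + S.𝔄 V ∈ S.evHerm0 ∧ ‖A + S.𝔄 V‖ < ρ} (S.sol V)) ∧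
        -- (c→s)
        (∀ V ∈ S.dom, ∀ A ∈ {A : Space115Lit F 2 K k Ω U₀ | A ∈ constraint102OfRecord F 2 K k Ω U₀ ∧ A + S.𝔄 V ∈ S.evHerm0 ∧ ‖A + S.𝔄 V‖ < ρ},
          IsMinOn (wilsonAction4 ∘ S.chartLin
              (fun _ => T47 (H1OfRecordAtBgFlat F 2 K k Ω U₀ levB a hposb hQ) (CslOfRecord F 2 K k Ω U₀ levB) εC) V)
            {A : Space115Lit F 2 K k Ω U₀ | A ∈ constraint102OfRecord F 2 K k Ω U₀ ∧ A + S.𝔄 V ∈ S.evHerm0 ∧ ‖A + S.𝔄 V‖ < ρ} A →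
          ‖A‖ ≤ S.ε₄ ∧ mapT (S.𝒢 V) 0 (S.W V) (S.J V) (S.𝔄 V) A = A) := by
  obtain ⟨ρ₀, M, γ, hρ₀, hρ₀aC, hM, hγ, hmain⟩ :=
    knitTokens_landau_two_of_row84 F k Ω U₀ levB a hposb hQ RC hCreal hCtr Gp Δ2 hposπ h hU₀reg hC haC c hc ι hι
  refine ⟨ρ₀, M, γ, hρ₀, hρ₀aC, hM, hγ, ?_⟩
  intro dom B₀ C₄ a₃ j a𝔄 ε₄ ρ S hS hρ hfit hdom hnum hdisc hR h𝔊 hL a₀ eq81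
  refine hmain dom B₀ C₄ a₃ j a𝔄 ε₄ ρ S hS hρ hfit hdom hnum hdisc hR h𝔊 hL ?_
  intro V hV A hA δ hδ
  subst hS
  have h84 := row84_of_eq81 F 2 k Ω U₀ levB a hposb hQ εC Gp Δ2 hposπ RC hC ι hι
    (hessOpOfRecord128_symm_of_hessSymmTok F 2 k U₀ Gp (QflatOfRecord F 2 k) hsym) dom B₀ C₄ a₃ j a𝔄 ε₄
    (fun _ => T47 (H1OfRecordAtBgFlat F 2 K k Ω U₀ levB a hposb hQ) (CslOfRecord F 2 K k Ω U₀ levB) εC) V hρ hρ₀aC (a₀ V) c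
    (fun A' hA' hlt => by simpa only [bgSchemeOfRecord_J, bgSchemeOfRecord_𝔄] using eq81 V hV A' hA' hlt) A
    (by simpa only [bgSchemeOfRecord_𝔄] using hA) δ hδ
  simpa only [bgSchemeOfRecord_J, bgSchemeOfRecord_W, bgSchemeOfRecord_𝔄] using h84

end Two

end Summit.QuantumFields.YangMills.Theorems.N07KnitTokensLandauTwoOfEq81

end
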